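import Summits.BirchSwinnertonDyer.BirchSwinnertonDyer.Theorems.PrintCFramBottomClassIndexLawFiveLeParitySplit
import Literature.NumberTheory.EllipticCurves.SelmerGroupCardinality
import HarnessLib

/-!
# Crux `PrintCFram.BottomClassIndexLawFiveLe` (stmt-BirchSwinnertonDyer-20372), line `eisenstein-resource-bdp-line` (registry v18), stub B1
# `stub_bsdp_of_classFactor`: THE REGISTRABLE FORM OF THE PARITY SPLIT (sequel §4–§7 to w2 g8's `…ParitySplit.lean`, p671334) — the dichotomy
# carried, losslessness on the small-Selmer branch, B1 ⟸ CT ∧ GZK ∧ B1-an♭ ∧ B1-ord with BOTH branch statements consequences of BSD, the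
# Ш-language form B1 ⟸ GZK ∧ B1-an′ ∧ B1-ord′ with NO extra print fact, and the dictionary `#Sel_p ≤ p² ⟺ Ш(W)[p] = 0` on rank-one members
# (cell `bsd-print-cfram`, width seat `bsd-line-cfram-p1-w3` g8; helper `--supports` 20372; THEOREMS ONLY: 0 defs, 0 facts, 0 sorry)

HONEST FRAMING. Nothing about BSD is proved here, no stub is closed, no summit statement is proved by this seat; the crux C2 stays OPEN and is NOT
claimed false. This is GLUE and bookkeeping around tree theorems (X11b Cassels–Tate parity, the typed Miller currency `Rank1Residual.Typed`, the descent
count `card_selmerGroup_eq_pow_rank_mul`), filed so that the LEAD / planner can REGISTER the split of B1 without registering a false statement.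

Why a sequel (input to LEAD g11's answer on the parity split, STATUS 2026-08-28T21:54:59Z (2)). §3's **B1-sel** «B1's binders ⟹
`#Sel_p(W/ℚ) ≤ p²`» is, for a rank-one member, the statement «`Ш(W)[p] = 0`» (`#Sel^{(p)} = p^{rank}·#W(ℚ)[p]·#Ш[p]`, Cassels–Tate parity);
class-wide (the class is closed under quadratic twisting) it is presumably FALSE — an Eisenstein-irregular rank-one member with `Ш(W)[p] ≠ 0`
refutes it — so it should not be REGISTERED as a stub. The dichotomy `natCard_selmerGroup_le_or_le` (§4) lets the split be carried honestly:
**B1-an♭** «B1's binders → `#Sel_p(W/ℚ) ≤ p²` → `∃ q, shaAn W = q ∧ padicValRat p q = 0`» and **B1-ord** «B1's binders → `p³ ≤ #Sel_p(W/ℚ)` →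
`BSDp W p`» are BOTH consequences of `BSD_p` on the class (§5 `shaAnUnit_of_bsdp_of_natCard_selmerGroup_le_sq` shows it for the first), and
§6 `bsdp_of_classFactor_of_casselsTate_of_shaAnUnit_of_order` gives B1 VERBATIM from `hCT`, `hGZK` and this pair; §6
`order_of_selLeSq` / `shaAnUnitFlat_of_shaAnUnit` record that {B1-sel, B1-an} ⟹ {B1-ord, B1-an♭}, i.e. the new pair is the WEAKER hypothesis set.
§5 `bsdp_iff_shaAn_unit_of_natCard_selmerGroup_le_sq`: on the small-Selmer branch the split is LOSSLESS — `BSDp W p ↔ p ∤ #Ш_an(W)` — so the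
research residue there is a statement about the ANALYTIC order of `Ш` alone (w2 g8 notes §4 (c): Heegner primitivity `M₀ = 0` by Gross–Zagier),
while `Ш(W)[p] = 0` is already a theorem of the branch (§5 `noPTorsion_of_natCard_selmerGroup_le_sq`). TURNKEY for an END STATE through LEAD g10's
`EisensteinEndStateV18.bottomClassIndexLawFiveLe_of_prints4_of_krizLi_of_classFactor_of_noAdmissibleField` (p669207; GZK is the crux's own antecedent):
`intro hGZK; exact EisensteinEndStateV18.… hprints4 hKL (ParitySplit.bsdp_of_classFactor_of_casselsTate_of_shaAnUnit_of_order hCT hGZK hAn hOrd) hB2 hGZK`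
(not landed here: the END STATE file is the LEAD's). §7 removes Cassels–Tate from the glue altogether: in Ш-LANGUAGE the branch statements are
**B1-an′** «B1's binders → `Ш(W)[p] = 0` → `p ∤ #Ш_an(W)`» and **B1-ord′** «B1's binders → `Ш(W)[p] ≠ 0` → `BSDp W p`», and
`bsdp_of_classFactor_of_shaAnUnit_of_sha` gives B1 ⟸ GZK ∧ B1-an′ ∧ B1-ord′ (GZK = the crux's antecedent; the first branch is the tree's
`Typed.bsdp_of_shaAn_unit_of_noPTorsion`), so an END STATE on this split needs NO fifth print fact:
`intro hGZK; exact EisensteinEndStateV18.… hprints4 hKL (ParitySplit.bsdp_of_classFactor_of_shaAnUnit_of_sha hGZK hAn' hOrd') hB2 hGZK`. Cassels–Tate enters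
only the DICTIONARY `natCard_selmerGroup_le_sq_iff_noPTorsion` / `cube_le_natCard_selmerGroup_iff_exists_sha` (rank-one member, `E(ℚ)[p] = 0` — on the class
w5 g3's `LevelDictionary.forall_nsmul_eq_zero_of_cmRamified`): `#Sel_p ≤ p² ⟺ Ш(W)[p] = 0`, `p³ ≤ #Sel_p ⟺ Ш(W)[p] ≠ 0`, which is how a `p`-descent DECIDES the
branch. THEOREMS ONLY; 0 defs / 0 facts / 0 sorry; closes no stub; BSD is not proved by any of this.
-/

set_option autoImplicit false
-- `…BirchSwinnertonDyer.BirchSwinnertonDyer.Theorems…` is the problem's mandated namespace (D-0017).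
set_option linter.dupNamespace false

noncomputable section

namespace Summit.BirchSwinnertonDyer.BirchSwinnertonDyer.Theorems.PrintCFram.ParitySplit

open scoped Classical

open WeierstrassCurve Literature.NumberTheory.EllipticCurves
  Literature.NumberTheory.EllipticCurves.Rank1Residual
  Literature.NumberTheory.EllipticCurves.Rank1Residual.Typed
  Literature.NumberTheory.EllipticCurves.KrizLi2019
  Summit.BirchSwinnertonDyer.Rank1Residual

/-! ## §4 The dichotomy -/

section Dichotomy

variable (W : WeierstrassCurve ℚ) [W.IsElliptic] (p : ℕ) [hp : Fact p.Prime]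

/-- **The honest dichotomy.** `#Sel^{(p)}(E/ℚ)` is a power of `p` (`exists_natCard_selmerGroup_eq_pow`: finite and killed by `p`), so for
every `k` either `#Sel_p ≤ p^k` or `p^(k+1) ≤ #Sel_p`. Bookkeeping. [cite: SilvermanAEC2009, Thm X.4.2(b)] -/
theorem natCard_selmerGroup_le_or_le (k : ℕ) :
    Nat.card (W.selmerGroup (p : ℤ)) ≤ p ^ k ∨ p ^ (k + 1) ≤ Nat.card (W.selmerGroup (p : ℤ)) := by
  obtain ⟨s, hs⟩ := exists_natCard_selmerGroup_eq_pow W p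
  rw [hs]
  rcases le_or_gt s k with h | h
  · exact Or.inl (Nat.pow_le_pow_right hp.out.pos h)
  · exact Or.inr (Nat.pow_le_pow_right hp.out.pos h)

end Dichotomy

/-! ## §5 The small-Selmer branch: `Ш[p] = 0`, and `BSD_p ⟺ p ∤ #Ш_an` (losslessness) -/

section SmallBranch

variable (W : WeierstrassCurve ℚ) [W.IsElliptic] (p : ℕ) [hp : Fact p.Prime]

/-- **`Ш(W/ℚ)[p] = 0` on the small-Selmer branch.** Granting the Cassels–Tate pairing (`hCT`) and Gross–Zagier–Kolyvagin (`hGZK`: `rank = r_an`,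
`Ш` finite): if `r_an(W) = 1` and `#Sel^{(p)}(W/ℚ) ≤ p²` then `Ш(W/ℚ)[p] = 0` — the `p`-rank of `Ш[p]` is even
(`X11b.noPTorsion_of_card_selmerGroup_lt_of_casselsTate` with `k ≤ 2 < rank + 2`). This is w2 g8 notes §4 (b)(i) «`dim Sel_p ≤ 2` ⟹ `Ш(W)[p^∞] = 0`»
as a kernel statement. [cite: SilvermanAEC2009, Thm X.4.14 and Thm X.4.2] [cite: Cassels1962ArithmeticIV] -/
theorem noPTorsion_of_natCard_selmerGroup_le_sq (hCT : exists_casselsTate_pairing (K := ℚ))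
    (hGZK : rank_eq_analyticRank_of_analyticRank_le_one) (hr : W.analyticRank = 1)
    (hcard : Nat.card (W.selmerGroup (p : ℤ)) ≤ p ^ 2) :
    ∀ x : W.sha, (p : ℤ) • x = 0 → x = 0 := by
  obtain ⟨hrank, hfin⟩ := hGZK W hr.le
  haveI : Finite W.sha := hfin
  obtain ⟨k, hk⟩ := exists_natCard_selmerGroup_eq_pow W p
  have hk2 : k ≤ 2 := by
    rw [hk] at hcard
    exact (Nat.pow_le_pow_iff_right hp.out.one_lt).mp hcard
  exact X11b.noPTorsion_of_card_selmerGroup_lt_of_casselsTate W hCT p hk (by rw [hrank, hr]; omega)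

/-- **BSD_p on the small-Selmer branch FORCES `p ∤ #Ш_an`** (the converse of §2): granting `hCT`, `hGZK`, if `r_an(W) = 1`,
`#Sel^{(p)}(W/ℚ) ≤ p²` and `BSD(W,p)` holds, then `#Ш_an(W)` is a rational `p`-adic unit — Miller's last clause gives `ord_p #Ш_an = ord_p #Ш`, and
`Ш[p] = 0` (previous theorem) gives `ord_p #Ш = 0` (`Typed.padicValNat_shaOrder_eq_zero_of_noPTorsion`). So B1-an♭ is a CONSEQUENCE of B1 (of BSD):
registering it cannot introduce a false stub. [cite: Miller2011LMS, §1 and Def. 1.1] [cite: SilvermanAEC2009, Thm X.4.14] -/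
theorem shaAnUnit_of_bsdp_of_natCard_selmerGroup_le_sq (hCT : exists_casselsTate_pairing (K := ℚ))
    (hGZK : rank_eq_analyticRank_of_analyticRank_le_one) (hr : W.analyticRank = 1)
    (hcard : Nat.card (W.selmerGroup (p : ℤ)) ≤ p ^ 2) (h : BSDp W p) :
    ∃ q : ℚ, shaAn W = (q : ℂ) ∧ padicValRat p q = 0 := by
  obtain ⟨-, hfin⟩ := hGZK W hr.le
  haveI : Finite W.sha := hfin
  obtain ⟨q, hq, hv⟩ := missingPPartAt_of_bsdp W p h
  refine ⟨q, hq, ?_⟩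
  rw [hv, padicValNat_shaOrder_eq_zero_of_noPTorsion W p hfin
    (noPTorsion_of_natCard_selmerGroup_le_sq W p hCT hGZK hr hcard), Nat.cast_zero]

/-- **The split is lossless: on the small-Selmer branch `BSD(W,p)` IS «`p ∤ #Ш_an(W)`».** Granting `hCT`, `hGZK`, for `r_an(W) = 1` and
`#Sel^{(p)}(W/ℚ) ≤ p²`: `BSDp W p ↔ ∃ q, shaAn W = q ∧ padicValRat p q = 0` (§2 `bsdp_of_natCard_selmerGroup_le_sq` and the previous theorem). So on this
branch the research residue of B1 is a statement about the ANALYTIC order of `Ш` alone (w2 g8 notes §4 (c): the `p`-primitivity of the Heegner point,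
`M₀ = 0`, by Gross–Zagier at a Heegner field with `p`-regular twist) and not about `Ш`. [cite: Miller2011LMS, §1 and Def. 1.1] [cite: Cassels1962ArithmeticIV] -/
theorem bsdp_iff_shaAn_unit_of_natCard_selmerGroup_le_sq (hCT : exists_casselsTate_pairing (K := ℚ))
    (hGZK : rank_eq_analyticRank_of_analyticRank_le_one) (hr : W.analyticRank = 1)
    (hcard : Nat.card (W.selmerGroup (p : ℤ)) ≤ p ^ 2) :
    BSDp W p ↔ ∃ q : ℚ, shaAn W = (q : ℂ) ∧ padicValRat p q = 0 :=
  ⟨shaAnUnit_of_bsdp_of_natCard_selmerGroup_le_sq W p hCT hGZK hr hcard,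
    fun ⟨_, hq, hv⟩ ↦ bsdp_of_natCard_selmerGroup_le_sq W p hCT hGZK hr hq hv hcard⟩

end SmallBranch

/-! ## §6 B1 ⟸ CT ∧ GZK ∧ B1-an♭ ∧ B1-ord (verbatim registered signature of `stub_bsdp_of_classFactor`), and the comparison with §3 -/

/-- **B1 from Cassels–Tate, GZK and the two BRANCH statements (the registrable split).** The registered statement of `stub_bsdp_of_classFactor`
(registry v17/v18: every CM-ramified rank-one member, `p ≥ 5`, with an odd Kriz–Li triple `(f, ψ, ω)` satisfying the trace form and a NON-UNIT
class factor `‖B_{1,ψ⁻¹}‖ ≤ p⁻¹`, satisfies `BSD(W,p)`) follows — granting `hCT` (Cassels 1962) and `hGZK` (the crux's antecedent) — from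
**B1-an♭** `hAn` (the same binders, AND `#Sel^{(p)}(W/ℚ) ≤ p²` ⟹ `#Ш_an(W)` is a rational `p`-adic unit: the Heegner-primitivity residue on the
small-Selmer branch) and **B1-ord** `hOrd` (the same binders, AND `p³ ≤ #Sel^{(p)}(W/ℚ)` ⟹ `BSD(W,p)`: the ORDER-form residue, members with
`Ш(W)[p] ≠ 0`, none on the window), by the dichotomy §4. Both branch statements are consequences of BSD on the class (§5
`shaAnUnit_of_bsdp_of_natCard_selmerGroup_le_sq` for the first; the second is BSD_p itself on its branch). CONDITIONAL; closes no stub; BSD is not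
proved by any of this. [cite: Cassels1962ArithmeticIV] [cite: Miller2011LMS, §1 and Def. 1.1] [cite: KrizLi2019, Thm. 1.20 (pp. 7–8)] -/
theorem bsdp_of_classFactor_of_casselsTate_of_shaAnUnit_of_order
    (hCT : exists_casselsTate_pairing (K := ℚ))
    (hGZK : rank_eq_analyticRank_of_analyticRank_le_one)
    (hAn : ∀ (W : WeierstrassCurve ℚ) [W.IsElliptic] [W.IsGloballyMinimal] (p : ℕ) [Fact p.Prime],
      W.HasCM → CMRamified W p → 5 ≤ p → W.analyticRank = 1 →
      ∀ (f : ℕ) [NeZero f] (ψ : DirichletCharacter ℚ_[p] f) (ω : DirichletCharacter ℚ_[p] p),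
        ψ.Odd → KrizLi2019.IsTeichmullerCharacter ω →
        (∀ ℓ : ℕ, ℓ.Prime → ¬ (ℓ ∣ p * W.conductorNorm ℤ) →
          ‖((W.LFunction ℓ : ℤ) : ℚ_[p]) - (ψ (ℓ : ZMod f) + ψ⁻¹ (ℓ : ZMod f) * ω (ℓ : ZMod p))‖ < 1) →
        ‖KrizLi2019.bernoulliOnePrim ψ⁻¹‖ ≤ (p : ℝ)⁻¹ →
        Nat.card (W.selmerGroup (p : ℤ)) ≤ p ^ 2 →
        ∃ q : ℚ, shaAn W = (q : ℂ) ∧ padicValRat p q = 0)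
    (hOrd : ∀ (W : WeierstrassCurve ℚ) [W.IsElliptic] [W.IsGloballyMinimal] (p : ℕ) [Fact p.Prime],
      W.HasCM → CMRamified W p → 5 ≤ p → W.analyticRank = 1 →
      ∀ (f : ℕ) [NeZero f] (ψ : DirichletCharacter ℚ_[p] f) (ω : DirichletCharacter ℚ_[p] p),
        ψ.Odd → KrizLi2019.IsTeichmullerCharacter ω →
        (∀ ℓ : ℕ, ℓ.Prime → ¬ (ℓ ∣ p * W.conductorNorm ℤ) →
          ‖((W.LFunction ℓ : ℤ) : ℚ_[p]) - (ψ (ℓ : ZMod f) + ψ⁻¹ (ℓ : ZMod f) * ω (ℓ : ZMod p))‖ < 1) →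
        ‖KrizLi2019.bernoulliOnePrim ψ⁻¹‖ ≤ (p : ℝ)⁻¹ →
        p ^ 3 ≤ Nat.card (W.selmerGroup (p : ℤ)) →
        BSDp W p) :
    ∀ (W : WeierstrassCurve ℚ) [W.IsElliptic] [W.IsGloballyMinimal] (p : ℕ) [Fact p.Prime],
      W.HasCM → CMRamified W p → 5 ≤ p → W.analyticRank = 1 →
      ∀ (f : ℕ) [NeZero f] (ψ : DirichletCharacter ℚ_[p] f) (ω : DirichletCharacter ℚ_[p] p),
        ψ.Odd → KrizLi2019.IsTeichmullerCharacter ω →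
        (∀ ℓ : ℕ, ℓ.Prime → ¬ (ℓ ∣ p * W.conductorNorm ℤ) →
          ‖((W.LFunction ℓ : ℤ) : ℚ_[p]) - (ψ (ℓ : ZMod f) + ψ⁻¹ (ℓ : ZMod f) * ω (ℓ : ZMod p))‖ < 1) →
        ‖KrizLi2019.bernoulliOnePrim ψ⁻¹‖ ≤ (p : ℝ)⁻¹ →
        BSDp W p := by
  intro W _ _ p _ hCM hram h5 hr f _ ψ ω hψ hω hss hB
  rcases natCard_selmerGroup_le_or_le W p 2 with hle | hge
  · obtain ⟨q, hq, hv⟩ := hAn W p hCM hram h5 hr f ψ ω hψ hω hss hB hle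
    exact bsdp_of_natCard_selmerGroup_le_sq W p hCT hGZK hr hq hv hle
  · exact hOrd W p hCM hram h5 hr f ψ ω hψ hω hss hB hge

/-- **§3's B1-sel makes B1-ord vacuous**: if every member as in B1 has `#Sel^{(p)}(W/ℚ) ≤ p²` (B1-sel), then B1-ord holds (its premise
`p³ ≤ #Sel_p` contradicts `#Sel_p ≤ p² < p³`). With `shaAnUnitFlat_of_shaAnUnit` this says {B1-sel, B1-an} ⟹ {B1-ord, B1-an♭}: the registrable pair
of §6 is the WEAKER hypothesis set. Bookkeeping. [cite: Miller2011LMS, §1 and Def. 1.1] -/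
theorem order_of_selLeSq
    (hsel : ∀ (W : WeierstrassCurve ℚ) [W.IsElliptic] [W.IsGloballyMinimal] (p : ℕ) [Fact p.Prime],
      W.HasCM → CMRamified W p → 5 ≤ p → W.analyticRank = 1 →
      ∀ (f : ℕ) [NeZero f] (ψ : DirichletCharacter ℚ_[p] f) (ω : DirichletCharacter ℚ_[p] p),
        ψ.Odd → KrizLi2019.IsTeichmullerCharacter ω →
        (∀ ℓ : ℕ, ℓ.Prime → ¬ (ℓ ∣ p * W.conductorNorm ℤ) →
          ‖((W.LFunction ℓ : ℤ) : ℚ_[p]) - (ψ (ℓ : ZMod f) + ψ⁻¹ (ℓ : ZMod f) * ω (ℓ : ZMod p))‖ < 1) →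
        ‖KrizLi2019.bernoulliOnePrim ψ⁻¹‖ ≤ (p : ℝ)⁻¹ →
        Nat.card (W.selmerGroup (p : ℤ)) ≤ p ^ 2) :
    ∀ (W : WeierstrassCurve ℚ) [W.IsElliptic] [W.IsGloballyMinimal] (p : ℕ) [Fact p.Prime],
      W.HasCM → CMRamified W p → 5 ≤ p → W.analyticRank = 1 →
      ∀ (f : ℕ) [NeZero f] (ψ : DirichletCharacter ℚ_[p] f) (ω : DirichletCharacter ℚ_[p] p),
        ψ.Odd → KrizLi2019.IsTeichmullerCharacter ω →
        (∀ ℓ : ℕ, ℓ.Prime → ¬ (ℓ ∣ p * W.conductorNorm ℤ) →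
          ‖((W.LFunction ℓ : ℤ) : ℚ_[p]) - (ψ (ℓ : ZMod f) + ψ⁻¹ (ℓ : ZMod f) * ω (ℓ : ZMod p))‖ < 1) →
        ‖KrizLi2019.bernoulliOnePrim ψ⁻¹‖ ≤ (p : ℝ)⁻¹ →
        p ^ 3 ≤ Nat.card (W.selmerGroup (p : ℤ)) →
        BSDp W p := by
  intro W _ _ p hpF hCM hram h5 hr f _ ψ ω hψ hω hss hB hge
  have hle := hsel W p hCM hram h5 hr f ψ ω hψ hω hss hB
  have hlt : p ^ 2 < p ^ 3 := Nat.pow_lt_pow_right hpF.out.one_lt (by norm_num)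
  exact absurd (hge.trans hle) (not_le.mpr hlt)

/-- **§3's B1-an gives B1-an♭** (drop the extra premise `#Sel_p ≤ p²`). Bookkeeping; with `order_of_selLeSq`, {B1-sel, B1-an} ⟹ {B1-ord, B1-an♭}.
[cite: Miller2011LMS, §1 and Def. 1.1] -/
theorem shaAnUnitFlat_of_shaAnUnit
    (han : ∀ (W : WeierstrassCurve ℚ) [W.IsElliptic] [W.IsGloballyMinimal] (p : ℕ) [Fact p.Prime],
      W.HasCM → CMRamified W p → 5 ≤ p → W.analyticRank = 1 →
      ∀ (f : ℕ) [NeZero f] (ψ : DirichletCharacter ℚ_[p] f) (ω : DirichletCharacter ℚ_[p] p),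
        ψ.Odd → KrizLi2019.IsTeichmullerCharacter ω →
        (∀ ℓ : ℕ, ℓ.Prime → ¬ (ℓ ∣ p * W.conductorNorm ℤ) →
          ‖((W.LFunction ℓ : ℤ) : ℚ_[p]) - (ψ (ℓ : ZMod f) + ψ⁻¹ (ℓ : ZMod f) * ω (ℓ : ZMod p))‖ < 1) →
        ‖KrizLi2019.bernoulliOnePrim ψ⁻¹‖ ≤ (p : ℝ)⁻¹ →
        ∃ q : ℚ, shaAn W = (q : ℂ) ∧ padicValRat p q = 0) :
    ∀ (W : WeierstrassCurve ℚ) [W.IsElliptic] [W.IsGloballyMinimal] (p : ℕ) [Fact p.Prime],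
      W.HasCM → CMRamified W p → 5 ≤ p → W.analyticRank = 1 →
      ∀ (f : ℕ) [NeZero f] (ψ : DirichletCharacter ℚ_[p] f) (ω : DirichletCharacter ℚ_[p] p),
        ψ.Odd → KrizLi2019.IsTeichmullerCharacter ω →
        (∀ ℓ : ℕ, ℓ.Prime → ¬ (ℓ ∣ p * W.conductorNorm ℤ) →
          ‖((W.LFunction ℓ : ℤ) : ℚ_[p]) - (ψ (ℓ : ZMod f) + ψ⁻¹ (ℓ : ZMod f) * ω (ℓ : ZMod p))‖ < 1) →
        ‖KrizLi2019.bernoulliOnePrim ψ⁻¹‖ ≤ (p : ℝ)⁻¹ →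
        Nat.card (W.selmerGroup (p : ℤ)) ≤ p ^ 2 →
        ∃ q : ℚ, shaAn W = (q : ℂ) ∧ padicValRat p q = 0 :=
  fun W _ _ p _ hCM hram h5 hr f _ ψ ω hψ hω hss hB _ ↦ han W p hCM hram h5 hr f ψ ω hψ hω hss hB

/-! ## §7 Ш-LANGUAGE: the split needs NO Cassels–Tate — B1 ⟸ GZK ∧ B1-an′ ∧ B1-ord′, and the dictionary `#Sel_p ≤ p² ⟺ Ш[p] = 0` on the class -/

section ShaLanguage

variable (W : WeierstrassCurve ℚ) [W.IsElliptic] (p : ℕ) [hp : Fact p.Prime]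

/-- **BSD_p with `Ш(W)[p] = 0` FORCES `p ∤ #Ш_an`** (no Cassels–Tate): granting GZK (`Ш` finite), in analytic rank `≤ 1`, if `Ш(W/ℚ)[p] = 0` and
`BSD(W,p)` holds then `#Ш_an(W)` is a rational `p`-adic unit (`Typed.missingPPartAt_of_bsdp` + `Typed.padicValNat_shaOrder_eq_zero_of_noPTorsion`). So the
Ш-language branch statement B1-an′ below is a CONSEQUENCE of BSD_p. [cite: Miller2011LMS, §1 and Def. 1.1] -/
theorem shaAnUnit_of_bsdp_of_noPTorsion (hGZK : rank_eq_analyticRank_of_analyticRank_le_one) (hr : W.analyticRank ≤ 1)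
    (h0 : ∀ x : W.sha, (p : ℤ) • x = 0 → x = 0) (h : BSDp W p) :
    ∃ q : ℚ, shaAn W = (q : ℂ) ∧ padicValRat p q = 0 := by
  obtain ⟨-, hfin⟩ := hGZK W hr
  haveI : Finite W.sha := hfin
  obtain ⟨q, hq, hv⟩ := missingPPartAt_of_bsdp W p h
  exact ⟨q, hq, by rw [hv, padicValNat_shaOrder_eq_zero_of_noPTorsion W p hfin h0, Nat.cast_zero]⟩

/-- **On the branch `Ш(W)[p] = 0`, `BSD(W,p)` IS «`p ∤ #Ш_an(W)`»** (no Cassels–Tate; GZK only): `BSDp W p ↔ ∃ q, shaAn W = q ∧ padicValRat p q = 0`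
((←) is the tree's `Typed.bsdp_of_shaAn_unit_of_noPTorsion`). [cite: Miller2011LMS, §1 and Def. 1.1] -/
theorem bsdp_iff_shaAn_unit_of_noPTorsion (hGZK : rank_eq_analyticRank_of_analyticRank_le_one) (hr : W.analyticRank ≤ 1)
    (h0 : ∀ x : W.sha, (p : ℤ) • x = 0 → x = 0) :
    BSDp W p ↔ ∃ q : ℚ, shaAn W = (q : ℂ) ∧ padicValRat p q = 0 :=
  ⟨shaAnUnit_of_bsdp_of_noPTorsion W p hGZK hr h0, fun ⟨_, hq, hv⟩ ↦ bsdp_of_shaAn_unit_of_noPTorsion W p hGZK hr hq hv h0⟩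

/-- **Descent count in rank one with no rational `p`-torsion**: `#Sel^{(p)}(E/ℚ) = p · #(Ш(E/ℚ) ∩ H¹(ℚ,E)[p])` when `rank E(ℚ) = 1` and `E(ℚ)[p] = 0`
(`card_selmerGroup_eq_pow_rank_mul`: `#Sel^{(p)} = p^{rank}·#E(ℚ)[p]·#Ш[p]`). On the class (`HasCM`, `p ≥ 5` CM-ramified) `E(ℚ)[p] = 0` is w5 g3's
`LevelDictionary.forall_nsmul_eq_zero_of_cmRamified`; here it is the hypothesis `htors`. [cite: SilvermanAEC2009, Thm X.4.2(a)] -/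
theorem natCard_selmerGroup_eq_mul_of_rank_one (hrank : W.mordellWeilRank = 1)
    (htors : ∀ P : W.toAffine.Point, p • P = 0 → P = 0) :
    Nat.card (W.selmerGroup (p : ℤ)) = p * Nat.card (W.sha ⊓ AddSubgroup.torsionBy W.galH1 p : AddSubgroup W.galH1) := by
  haveI : NeZero p := ⟨hp.out.ne_zero⟩
  -- `#E(ℚ)[p] = 1`
  have hcard1 : Nat.card (AddSubgroup.torsionBy W.toAffine.Point p) = 1 := by
    refine Nat.card_eq_one_iff_unique.mpr ⟨⟨fun a b ↦ ?_⟩, ⟨0⟩⟩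
    have ha : (a : W.toAffine.Point) = 0 := htors a (AddSubgroup.torsionBy.nsmul_iff.mp a.2)
    have hb : (b : W.toAffine.Point) = 0 := htors b (AddSubgroup.torsionBy.nsmul_iff.mp b.2)
    exact Subtype.ext (ha.trans hb.symm)
  have key := card_selmerGroup_eq_pow_rank_mul W p
  rw [hrank, pow_one] at key
  rw [key]
  congr 1
  conv_rhs => rw [← mul_one p]
  congr 1
  -- the generic-`K` descent count carries the classical `DecidableEq` on `E(ℚ)`; `convert` bridges it to `instDecidableEqRat` (Subsingleton)
  convert hcard1

omit [W.IsElliptic] hp in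
/-- `Ш(E) ∩ H¹(ℚ,E)[p]` is trivial iff `Ш(E)[p] = 0` (the two ways of saying «no element of order `p` in Ш»). Bookkeeping. [folklore] -/
theorem sha_inf_torsionBy_eq_bot_iff :
    (W.sha ⊓ AddSubgroup.torsionBy W.galH1 p : AddSubgroup W.galH1) = ⊥ ↔ ∀ x : W.sha, (p : ℤ) • x = 0 → x = 0 := by
  constructor
  · intro h x hx
    have h2 : (p : ℤ) • (x : W.galH1) = 0 := by
      have h1 := congrArg (fun z : W.sha ↦ (z : W.galH1)) hx
      simpa only [AddSubgroupClass.coe_zsmul, ZeroMemClass.coe_zero] using h1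
    have hmem : (x : W.galH1) ∈ (W.sha ⊓ AddSubgroup.torsionBy W.galH1 p : AddSubgroup W.galH1) := by
      refine AddSubgroup.mem_inf.mpr ⟨x.2, AddSubgroup.torsionBy.nsmul_iff.mpr ?_⟩
      rw [← natCast_zsmul]
      exact h2
    rw [h, AddSubgroup.mem_bot] at hmem
    exact Subtype.ext hmem
  · intro h
    rw [eq_bot_iff]
    intro y hy
    rw [AddSubgroup.mem_bot]
    obtain ⟨hyS, hyT⟩ := AddSubgroup.mem_inf.mp hy
    have hyp : p • y = 0 := AddSubgroup.torsionBy.nsmul_iff.mp hyT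
    have hyz : (p : ℤ) • y = 0 := by rw [natCast_zsmul]; exact hyp
    have h1 : (⟨y, hyS⟩ : W.sha) = 0 := h ⟨y, hyS⟩ (Subtype.ext (by
      simpa only [AddSubgroupClass.coe_zsmul, ZeroMemClass.coe_zero] using hyz))
    exact congrArg (fun z : W.sha ↦ (z : W.galH1)) h1

/-- **THE DICTIONARY on a rank-one member with `E(ℚ)[p] = 0`: `#Sel^{(p)}(E/ℚ) ≤ p² ⟺ Ш(E/ℚ)[p] = 0`** (granting Cassels–Tate and GZK; (→) is §5,
(←) is the descent count `#Sel_p = p·#Ш[p] = p`). So w2 g8's B1-sel / this file's B1-an♭ premise is «`Ш(W)[p] = 0`» and B1-ord's premise is «`Ш(W)[p] ≠ 0`» —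
the LEVEL DICTIONARY's second alternative (LEAD g10 report §2(d)(β); w4 g8 `LevelDictionary.levelPos_or_sha_of_unramified_sub_class`, w5 g3's (β) consumer).
[cite: SilvermanAEC2009, Thm X.4.14 and Thm X.4.2] [cite: Cassels1962ArithmeticIV] -/
theorem natCard_selmerGroup_le_sq_iff_noPTorsion (hCT : exists_casselsTate_pairing (K := ℚ))
    (hGZK : rank_eq_analyticRank_of_analyticRank_le_one) (hr : W.analyticRank = 1)
    (htors : ∀ P : W.toAffine.Point, p • P = 0 → P = 0) :
    Nat.card (W.selmerGroup (p : ℤ)) ≤ p ^ 2 ↔ ∀ x : W.sha, (p : ℤ) • x = 0 → x = 0 := by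
  refine ⟨noPTorsion_of_natCard_selmerGroup_le_sq W p hCT hGZK hr, fun h ↦ ?_⟩
  obtain ⟨hrank, -⟩ := hGZK W hr.le
  rw [natCard_selmerGroup_eq_mul_of_rank_one W p (by rw [hrank, hr]) htors, (sha_inf_torsionBy_eq_bot_iff W p).mpr h,
    AddSubgroup.card_bot, mul_one]
  calc p = p ^ 1 := (pow_one p).symm
    _ ≤ p ^ 2 := Nat.pow_le_pow_right hp.out.pos (by norm_num)

/-- **The other branch in Ш-language: `p³ ≤ #Sel^{(p)}(E/ℚ) ⟺ Ш(E/ℚ)[p] ≠ 0`** on a rank-one member with `E(ℚ)[p] = 0` (granting CT and GZK).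
[cite: SilvermanAEC2009, Thm X.4.14 and Thm X.4.2] [cite: Cassels1962ArithmeticIV] -/
theorem cube_le_natCard_selmerGroup_iff_exists_sha (hCT : exists_casselsTate_pairing (K := ℚ))
    (hGZK : rank_eq_analyticRank_of_analyticRank_le_one) (hr : W.analyticRank = 1)
    (htors : ∀ P : W.toAffine.Point, p • P = 0 → P = 0) :
    p ^ 3 ≤ Nat.card (W.selmerGroup (p : ℤ)) ↔ ∃ c : W.sha, c ≠ 0 ∧ (p : ℤ) • c = 0 := by
  have hlt : p ^ 2 < p ^ 3 := Nat.pow_lt_pow_right hp.out.one_lt (by norm_num)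
  have hiff := natCard_selmerGroup_le_sq_iff_noPTorsion W p hCT hGZK hr htors
  constructor
  · intro h3
    by_contra hne
    have h0 : ∀ x : W.sha, (p : ℤ) • x = 0 → x = 0 := fun x hx ↦ by
      by_contra hx0
      exact hne ⟨x, hx0, hx⟩
    exact absurd (h3.trans (hiff.mpr h0)) (not_le.mpr hlt)
  · rintro ⟨c, hc0, hc⟩
    rcases natCard_selmerGroup_le_or_le W p 2 with hle | hge
    · exact absurd (hiff.mp hle c hc) hc0
    · exact hge

end ShaLanguage

/-- **B1 ⟸ GZK ∧ B1-an′ ∧ B1-ord′ — the split in Ш-language, with NO extra print fact.** The registered statement of `stub_bsdp_of_classFactor` follows —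
granting only `hGZK` (the crux's own antecedent) — from **B1-an′** `hAn` («B1's binders → `Ш(W)[p] = 0` → `∃ q, shaAn W = q ∧ padicValRat p q = 0`»: on the
Ш[p]-trivial branch the residue is the `p`-adic unit-ness of the analytic order of Ш alone, = Heegner primitivity `M₀ = 0` by Gross–Zagier, w2 g8 notes §4 (c)) and
**B1-ord′** `hOrd` («B1's binders → `(∃ c ∈ Ш(W), c ≠ 0 ∧ p • c = 0)` → `BSDp W p`»: the ORDER-form residue). Case split on `Ш(W)[p] = 0`; the first branch is the tree's
`Typed.bsdp_of_shaAn_unit_of_noPTorsion`. Both branch statements are consequences of BSD_p (`shaAnUnit_of_bsdp_of_noPTorsion`), so registering them introduces no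
refutable stub; by §7's dictionary they are the Selmer-language B1-an♭ / B1-ord of §6 (Cassels–Tate enters only there). CONDITIONAL; closes no stub; BSD is not
proved by any of this. [cite: Miller2011LMS, §1 and Def. 1.1] [cite: KrizLi2019, Thm. 1.20 (pp. 7–8)] [cite: BurungaleKobayashiNakamuraOta2026, §1.4 (arXiv:2608.06879 p. 8)] -/
theorem bsdp_of_classFactor_of_shaAnUnit_of_sha
    (hGZK : rank_eq_analyticRank_of_analyticRank_le_one)
    (hAn : ∀ (W : WeierstrassCurve ℚ) [W.IsElliptic] [W.IsGloballyMinimal] (p : ℕ) [Fact p.Prime],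
      W.HasCM → CMRamified W p → 5 ≤ p → W.analyticRank = 1 →
      ∀ (f : ℕ) [NeZero f] (ψ : DirichletCharacter ℚ_[p] f) (ω : DirichletCharacter ℚ_[p] p),
        ψ.Odd → KrizLi2019.IsTeichmullerCharacter ω →
        (∀ ℓ : ℕ, ℓ.Prime → ¬ (ℓ ∣ p * W.conductorNorm ℤ) →
          ‖((W.LFunction ℓ : ℤ) : ℚ_[p]) - (ψ (ℓ : ZMod f) + ψ⁻¹ (ℓ : ZMod f) * ω (ℓ : ZMod p))‖ < 1) →
        ‖KrizLi2019.bernoulliOnePrim ψ⁻¹‖ ≤ (p : ℝ)⁻¹ →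
        (∀ x : W.sha, (p : ℤ) • x = 0 → x = 0) →
        ∃ q : ℚ, shaAn W = (q : ℂ) ∧ padicValRat p q = 0)
    (hOrd : ∀ (W : WeierstrassCurve ℚ) [W.IsElliptic] [W.IsGloballyMinimal] (p : ℕ) [Fact p.Prime],
      W.HasCM → CMRamified W p → 5 ≤ p → W.analyticRank = 1 →
      ∀ (f : ℕ) [NeZero f] (ψ : DirichletCharacter ℚ_[p] f) (ω : DirichletCharacter ℚ_[p] p),
        ψ.Odd → KrizLi2019.IsTeichmullerCharacter ω →
        (∀ ℓ : ℕ, ℓ.Prime → ¬ (ℓ ∣ p * W.conductorNorm ℤ) →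
          ‖((W.LFunction ℓ : ℤ) : ℚ_[p]) - (ψ (ℓ : ZMod f) + ψ⁻¹ (ℓ : ZMod f) * ω (ℓ : ZMod p))‖ < 1) →
        ‖KrizLi2019.bernoulliOnePrim ψ⁻¹‖ ≤ (p : ℝ)⁻¹ →
        (∃ c : W.sha, c ≠ 0 ∧ (p : ℤ) • c = 0) →
        BSDp W p) :
    ∀ (W : WeierstrassCurve ℚ) [W.IsElliptic] [W.IsGloballyMinimal] (p : ℕ) [Fact p.Prime],
      W.HasCM → CMRamified W p → 5 ≤ p → W.analyticRank = 1 →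
      ∀ (f : ℕ) [NeZero f] (ψ : DirichletCharacter ℚ_[p] f) (ω : DirichletCharacter ℚ_[p] p),
        ψ.Odd → KrizLi2019.IsTeichmullerCharacter ω →
        (∀ ℓ : ℕ, ℓ.Prime → ¬ (ℓ ∣ p * W.conductorNorm ℤ) →
          ‖((W.LFunction ℓ : ℤ) : ℚ_[p]) - (ψ (ℓ : ZMod f) + ψ⁻¹ (ℓ : ZMod f) * ω (ℓ : ZMod p))‖ < 1) →
        ‖KrizLi2019.bernoulliOnePrim ψ⁻¹‖ ≤ (p : ℝ)⁻¹ →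
        BSDp W p := by
  intro W _ _ p _ hCM hram h5 hr f _ ψ ω hψ hω hss hB
  by_cases h0 : ∀ x : W.sha, (p : ℤ) • x = 0 → x = 0
  · obtain ⟨q, hq, hv⟩ := hAn W p hCM hram h5 hr f ψ ω hψ hω hss hB h0
    exact bsdp_of_shaAn_unit_of_noPTorsion W p hGZK hr.le hq hv h0
  · obtain ⟨c, hc⟩ := not_forall.mp h0
    obtain ⟨hc, hc0⟩ := Classical.not_imp.mp hc
    exact hOrd W p hCM hram h5 hr f ψ ω hψ hω hss hB ⟨c, hc0, hc⟩

end Summit.BirchSwinnertonDyer.BirchSwinnertonDyer.Theorems.PrintCFram.ParitySplit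

end
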